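import Literature.NumberTheory.EllipticCurves.KubotaLeopoldtTwoNumerator
import HarnessLib

/-!
# Route `EisensteinDepletionAtTwo`, crux E1M `DepletedLambdaLawAtTwoMod` (item stmt-BirchSwinnertonDyer-20341), line `star`,
# stub `stub_starEisNorm` step (E3): the FINITE-LEVEL CONVOLUTION THEOREM for the Mazur–Tate–Teitelbaum Riemann sums

Cell `bsd-rank2` (HOME run/shared/lean/pub/bsd-rank2/), seat `bsd-rank2-star-p1` (lead of line `star`; plan memo
`Cruxes/DepletedLambdaLawAtTwoMod/StarEisNormPlan.md`, step (E3)). THEOREMS ONLY — no definition, no named fact, no `sorry`.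
HONEST FRAMING: generic group-ring bookkeeping for the Riemann sums of `PAdicMeasureTransform` / `KubotaLeopoldtTwoNumerator`
(any prime `p`, any commutative coefficient ring); it is the algebraic engine by which the (★-EisNorm) half of line `star`
("the C-normalised Eisenstein measure is a convolution `E₁ ⋆ E₁^ι`, so its transform is `G·G^ι`·(factors)") becomes a statement
about Riemann sums. Nothing here reads an analytic rank; BSD is not proved by any of this (PARTITION D-0054: none — r_an ≥ 2 axis S0).

* `X_pow_sub_one_dvd_genPoly_conv_sub_mul` — for set functions `F, G, K` on `ℤ/p^{n+e₀}` with `K(a) = Σ_{u unit} F(u)·G(a u⁻¹)`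
  on the units, the generating polynomials `P_F(U) = Σ_η Σ_{s mod pⁿ} F(ηγ^s) U^s` (`η` over the Teichmüller representatives,
  `γ = 1 + p^{e₀}`, `s ∈ [0,pⁿ)`) satisfy `U^{pⁿ} − 1 ∣ P_K − P_F·P_G`: `(η,s) ↦ ηγ^s` is a bijection onto `(ℤ/p^{n+e₀})^×`
  (tree: `classMap_injective`, `card_classDomain`, `isUnit_classMap`) and is multiplicative with `s` added modulo
  `pⁿ = ord γ` (`orderOf_cyclotomicGenerator`).
* `distributionRiemannSum_eq_coeff_genPoly_comp` — `RS_μ(k,n) = [Tᵏ] P_μ(1+T)` (`(1+T)^s = Σ C(s,k)Tᵏ`).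

References: S. Lang, *Cyclotomic Fields I and II*, GTM 121, Ch. 4 §2 (operations on measures; the power series of a
convolution is the product) [LangCyclotomic1990]; B. Mazur, J. Tate, J. Teitelbaum, Invent. Math. 84 (1986), §I.13
[MazurTateTeitelbaum1986Invent].
-/

set_option linter.dupNamespace false
set_option autoImplicit false

noncomputable section

open scoped Classical
open Polynomial Filter Topology Literature.NumberTheory.EllipticCurves

namespace Summit.BirchSwinnertonDyer.BirchSwinnertonDyer.Theorems.DepletionAtTwo

variable {p : ℕ} [Fact p.Prime] {R : Type*} [CommRing R]

/-- **The sample points are multiplicative**: `(ηγ^s)(η'γ^{s'}) = (ηη')γ^{(s+s') mod pⁿ}` in `ℤ/p^{n+e₀}` (`γ` has order `pⁿ`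
there, `orderOf_cyclotomicGenerator`). [cite: MazurTateTeitelbaum1986Invent, §I.13] -/
theorem toZModPow_mul_cyclotomicGenerator_pow_mul (n : ℕ) (η η' : rootsOfUnity (torsionOrder p) ℤ_[p]) (s s' : ZMod (p ^ n)) :
    (PadicInt.toZModPow (n + cyclotomicExponent p) ((η : ℤ_[p]ˣ) : ℤ_[p]) *
        (cyclotomicGenerator p : ZMod (p ^ (n + cyclotomicExponent p))) ^ s.val) *
      (PadicInt.toZModPow (n + cyclotomicExponent p) ((η' : ℤ_[p]ˣ) : ℤ_[p]) *
        (cyclotomicGenerator p : ZMod (p ^ (n + cyclotomicExponent p))) ^ s'.val) =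
      PadicInt.toZModPow (n + cyclotomicExponent p) (((η * η' : rootsOfUnity (torsionOrder p) ℤ_[p]) : ℤ_[p]ˣ) : ℤ_[p]) *
        (cyclotomicGenerator p : ZMod (p ^ (n + cyclotomicExponent p))) ^ (s + s').val := by
  haveI : NeZero (p ^ n) := ⟨pow_ne_zero _ (Fact.out : p.Prime).ne_zero⟩
  have hfin : IsOfFinOrder (cyclotomicGenerator p : ZMod (p ^ (n + cyclotomicExponent p))) :=
    orderOf_pos_iff.mp (by rw [orderOf_cyclotomicGenerator]; exact pow_pos (Fact.out : p.Prime).pos _)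
  have hγ : (cyclotomicGenerator p : ZMod (p ^ (n + cyclotomicExponent p))) ^ (s.val + s'.val) =
      (cyclotomicGenerator p : ZMod (p ^ (n + cyclotomicExponent p))) ^ (s + s').val := by
    rw [hfin.pow_eq_pow_iff_modEq, orderOf_cyclotomicGenerator, ZMod.val_add]
    exact (Nat.mod_modEq _ _).symm
  have hφ : PadicInt.toZModPow (n + cyclotomicExponent p)
        (((η * η' : rootsOfUnity (torsionOrder p) ℤ_[p]) : ℤ_[p]ˣ) : ℤ_[p]) =
      PadicInt.toZModPow (n + cyclotomicExponent p) ((η : ℤ_[p]ˣ) : ℤ_[p]) *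
        PadicInt.toZModPow (n + cyclotomicExponent p) ((η' : ℤ_[p]ˣ) : ℤ_[p]) := by
    rw [Subgroup.coe_mul, Units.val_mul, map_mul]
  rw [hφ, ← hγ, pow_add (cyclotomicGenerator p : ZMod (p ^ (n + cyclotomicExponent p))) s.val s'.val]
  ring

/-- **Finite-level convolution theorem for the generating polynomials of the Riemann sums.** For set functions
`F, G, K` on `ℤ/p^{n+e₀}` with values in a commutative ring such that `K` is the multiplicative CONVOLUTION of `F` and
`G` on the units, `K(a) = Σ_{u ∈ (ℤ/p^{n+e₀})^×} F(u)·G(a·u⁻¹)` for every unit `a`, the generating polynomials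
`P_F(U) = Σ_{η} Σ_{s mod pⁿ} F(η γ^s)·U^s` (`η` over the Teichmüller representatives, `γ = 1 + p^{e₀}`, `s ∈ [0, pⁿ)`) satisfy
`P_K ≡ P_F · P_G  (mod U^{pⁿ} − 1)`: the group ring `R[(ℤ/p^{n+e₀})^×]` maps onto `R[Γ/Γ^{pⁿ}] = R[U]/(U^{pⁿ} − 1)`,
`η γ^s ↦ U^s`, and convolution goes to product (Lang, Cyclotomic Fields I–II, Ch. 4 §2; Mazur–Tate–Teitelbaum §I.13).
[cite: LangCyclotomic1990, Ch. 4 §2 (operations on measures)] [cite: MazurTateTeitelbaum1986Invent, §I.13] -/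
theorem X_pow_sub_one_dvd_genPoly_conv_sub_mul (n : ℕ)
    (F G K : ZMod (p ^ (n + cyclotomicExponent p)) → R)
    (hK : ∀ a : (ZMod (p ^ (n + cyclotomicExponent p)))ˣ,
      K a = ∑ u : (ZMod (p ^ (n + cyclotomicExponent p)))ˣ, F u * G (a * ↑u⁻¹)) :
    (X ^ (p ^ n) - 1 : R[X]) ∣
      (∑ᶠ η : rootsOfUnity (torsionOrder p) ℤ_[p], ∑ s : ZMod (p ^ n),
          C (K (PadicInt.toZModPow (n + cyclotomicExponent p) ((η : ℤ_[p]ˣ) : ℤ_[p]) *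
            (cyclotomicGenerator p : ZMod (p ^ (n + cyclotomicExponent p))) ^ s.val)) * X ^ s.val) -
      (∑ᶠ η : rootsOfUnity (torsionOrder p) ℤ_[p], ∑ s : ZMod (p ^ n),
          C (F (PadicInt.toZModPow (n + cyclotomicExponent p) ((η : ℤ_[p]ˣ) : ℤ_[p]) *
            (cyclotomicGenerator p : ZMod (p ^ (n + cyclotomicExponent p))) ^ s.val)) * X ^ s.val) *
      (∑ᶠ η : rootsOfUnity (torsionOrder p) ℤ_[p], ∑ s : ZMod (p ^ n),
          C (G (PadicInt.toZModPow (n + cyclotomicExponent p) ((η : ℤ_[p]ˣ) : ℤ_[p]) *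
            (cyclotomicGenerator p : ZMod (p ^ (n + cyclotomicExponent p))) ^ s.val)) * X ^ s.val) := by
  classical
  haveI := neZero_torsionOrder p
  haveI : NeZero (p ^ n) := ⟨pow_ne_zero _ (Fact.out : p.Prime).ne_zero⟩
  haveI : Fintype (rootsOfUnity (torsionOrder p) ℤ_[p]) := Fintype.ofFinite _
  -- abbreviations: the index type and the sample points
  set T := rootsOfUnity (torsionOrder p) ℤ_[p] × ZMod (p ^ n) with hT
  set pt : T → ZMod (p ^ (n + cyclotomicExponent p)) := fun x ↦
    PadicInt.toZModPow (n + cyclotomicExponent p) ((x.1 : ℤ_[p]ˣ) : ℤ_[p]) *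
      (cyclotomicGenerator p : ZMod (p ^ (n + cyclotomicExponent p))) ^ x.2.val with hpt
  -- the sample-point map is a bijection onto the units and is multiplicative
  set Φ : T → (ZMod (p ^ (n + cyclotomicExponent p)))ˣ := fun x ↦ (isUnit_classMap p n x).unit with hΦ
  have hΦval : ∀ x, ((Φ x : (ZMod (p ^ (n + cyclotomicExponent p)))ˣ) : ZMod (p ^ (n + cyclotomicExponent p))) =
      pt x := fun x ↦ by
    simp only [hΦ, hpt, IsUnit.unit_spec]
  have hΦinj : Function.Injective Φ := by
    intro x y hxy
    have h := congr_arg Units.val hxy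
    rw [hΦval, hΦval] at h
    exact classMap_injective p n h
  have hΦbij : Function.Bijective Φ :=
    (Fintype.bijective_iff_injective_and_card Φ).mpr ⟨hΦinj, card_classDomain p n⟩
  have hmul : ∀ x y : T, pt x * pt y = pt (x.1 * y.1, x.2 + y.2) := by
    rintro ⟨η, s⟩ ⟨η', s'⟩
    simp only [hpt]
    exact toZModPow_mul_cyclotomicGenerator_pow_mul n η η' s s'
  -- the three generating polynomials as sums over `T`
  have hprod : ∀ (H : ZMod (p ^ (n + cyclotomicExponent p)) → R),
      (∑ᶠ η : rootsOfUnity (torsionOrder p) ℤ_[p], ∑ s : ZMod (p ^ n),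
          C (H (PadicInt.toZModPow (n + cyclotomicExponent p) ((η : ℤ_[p]ˣ) : ℤ_[p]) *
            (cyclotomicGenerator p : ZMod (p ^ (n + cyclotomicExponent p))) ^ s.val)) * X ^ s.val) =
        ∑ x : T, C (H (pt x)) * X ^ x.2.val := by
    intro H
    rw [finsum_eq_sum_of_fintype, ← Fintype.sum_prod_type']
  rw [hprod K, hprod F, hprod G]
  -- (1) the convolution side as a double sum, reindexed
  have hKx : ∀ x : T, K (pt x) = ∑ y : T, F (pt y) * G (pt (x.1 * y.1⁻¹, x.2 - y.2)) := by
    intro x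
    rw [← hΦval x, hK (Φ x)]
    refine (Fintype.sum_bijective Φ hΦbij (fun y ↦ F (pt y) * G (pt (x.1 * y.1⁻¹, x.2 - y.2)))
      (fun u ↦ F u * G (Φ x * ↑u⁻¹)) (fun y ↦ ?_)).symm
    rw [hΦval y]
    congr 1
    have h1 : ((Φ x : (ZMod (p ^ (n + cyclotomicExponent p)))ˣ) : ZMod (p ^ (n + cyclotomicExponent p))) =
        pt (x.1 * y.1⁻¹, x.2 - y.2) *
          ((Φ y : (ZMod (p ^ (n + cyclotomicExponent p)))ˣ) : ZMod (p ^ (n + cyclotomicExponent p))) := by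
      rw [hΦval, hΦval, hmul]
      simp only [inv_mul_cancel_right, sub_add_cancel, Prod.mk.eta]
    rw [h1, Units.mul_inv_cancel_right]
  let e : T × T ≃ T × T :=
    { toFun := fun q ↦ ((q.1.1 * q.2.1, q.1.2 + q.2.2), q.2)
      invFun := fun q ↦ ((q.1.1 * q.2.1⁻¹, q.1.2 - q.2.2), q.2)
      left_inv := fun q ↦ by simp
      right_inv := fun q ↦ by simp }
  have hS_K : ∑ x : T, C (K (pt x)) * X ^ x.2.val =
      ∑ q : T × T, C (F (pt q.2) * G (pt q.1)) * X ^ (q.1.2 + q.2.2).val := by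
    have h1 : ∑ x : T, C (K (pt x)) * X ^ x.2.val =
        ∑ q : T × T, C (F (pt q.2) * G (pt (q.1.1 * q.2.1⁻¹, q.1.2 - q.2.2))) * X ^ q.1.2.val := by
      rw [Fintype.sum_prod_type (f := fun q : T × T ↦
        C (F (pt q.2) * G (pt (q.1.1 * q.2.1⁻¹, q.1.2 - q.2.2))) * X ^ q.1.2.val)]
      refine Finset.sum_congr rfl fun x _ ↦ ?_
      rw [hKx x, map_sum, Finset.sum_mul]
    rw [h1, ← Equiv.sum_comp e]
    refine Finset.sum_congr rfl fun q _ ↦ ?_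
    simp only [e, Equiv.coe_fn_mk, mul_inv_cancel_right, add_sub_cancel_right, Prod.mk.eta]
  -- (2) the product side as a double sum over the same index
  have hS_FG : (∑ x : T, C (F (pt x)) * X ^ x.2.val) * (∑ x : T, C (G (pt x)) * X ^ x.2.val) =
      ∑ q : T × T, C (F (pt q.2) * G (pt q.1)) * X ^ (q.1.2.val + q.2.2.val) := by
    rw [Finset.sum_mul_sum, Fintype.sum_prod_type_right (f := fun q : T × T ↦
      C (F (pt q.2) * G (pt q.1)) * X ^ (q.1.2.val + q.2.2.val))]
    refine Finset.sum_congr rfl fun x _ ↦ Finset.sum_congr rfl fun y _ ↦ ?_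
    rw [map_mul, pow_add]
    ring
  rw [hS_K, hS_FG, ← Finset.sum_sub_distrib]
  refine Finset.dvd_sum fun q _ ↦ ?_
  -- (3) termwise: the exponents agree mod `p^n`
  obtain ⟨c, hc⟩ : ∃ c : ℕ, q.1.2.val + q.2.2.val = (q.1.2 + q.2.2).val + p ^ n * c := by
    have hmod : (q.1.2 + q.2.2).val = (q.1.2.val + q.2.2.val) % p ^ n := ZMod.val_add _ _
    refine ⟨(q.1.2.val + q.2.2.val) / p ^ n, ?_⟩
    rw [hmod]
    exact (Nat.mod_add_div _ _).symm
  have h' : (X ^ (p ^ n) - 1 : R[X]) ∣ 1 - X ^ (p ^ n * c) := by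
    have h : (X ^ (p ^ n) - 1 : R[X]) ∣ (X ^ (p ^ n)) ^ c - 1 ^ c := sub_dvd_pow_sub_pow _ _ _
    rw [one_pow, ← pow_mul] at h
    rw [show (1 : R[X]) - X ^ (p ^ n * c) = -(X ^ (p ^ n * c) - 1) from (neg_sub _ _).symm]
    exact h.neg_right
  rw [hc, pow_add]
  have hring : C (F (pt q.2) * G (pt q.1)) * X ^ (q.1.2 + q.2.2).val -
      C (F (pt q.2) * G (pt q.1)) * (X ^ (q.1.2 + q.2.2).val * X ^ (p ^ n * c)) =
      (C (F (pt q.2) * G (pt q.1)) * X ^ (q.1.2 + q.2.2).val) * (1 - X ^ (p ^ n * c)) := by ring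
  rw [hring]
  exact h'.mul_left _

/-- **The Riemann sums are the Taylor coefficients at `U = 1` of the generating polynomial**:
`RS_μ(k, n) = [Tᵏ] P_μ(1 + T)`, where `P_μ(U) = Σ_η Σ_{s mod pⁿ} μ(ηγ^s)·U^s` (`(1+T)^s = Σ_k C(s,k)T^k`).
Together with `X_pow_sub_one_dvd_genPoly_conv_sub_mul` this is how a convolution identity of set functions becomes an
identity of Riemann sums modulo the ideal generated by `(1+T)^{pⁿ} − 1`. [cite: MazurTateTeitelbaum1986Invent, §I.13] -/
theorem distributionRiemannSum_eq_coeff_genPoly_comp (μ : (n : ℕ) → ZMod (p ^ n) → ℚ_[p]) (k n : ℕ) :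
    distributionRiemannSum μ k n =
      ((∑ᶠ η : rootsOfUnity (torsionOrder p) ℤ_[p], ∑ s : ZMod (p ^ n),
          C (μ (n + cyclotomicExponent p) (PadicInt.toZModPow (n + cyclotomicExponent p) ((η : ℤ_[p]ˣ) : ℤ_[p]) *
            (cyclotomicGenerator p : ZMod (p ^ (n + cyclotomicExponent p))) ^ s.val)) * X ^ s.val).comp (X + 1)).coeff k := by
  classical
  haveI := neZero_torsionOrder p
  haveI : Fintype (rootsOfUnity (torsionOrder p) ℤ_[p]) := Fintype.ofFinite _
  rw [distributionRiemannSum, finsum_eq_sum_of_fintype, finsum_eq_sum_of_fintype, Polynomial.sum_comp,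
    Polynomial.finsetSum_coeff]
  refine Finset.sum_congr rfl fun η _ ↦ ?_
  rw [Polynomial.sum_comp, Polynomial.finsetSum_coeff]
  refine Finset.sum_congr rfl fun s _ ↦ ?_
  rw [Polynomial.mul_comp, Polynomial.C_comp, Polynomial.X_pow_comp, Polynomial.coeff_C_mul,
    Polynomial.coeff_X_add_one_pow]

end Summit.BirchSwinnertonDyer.BirchSwinnertonDyer.Theorems.DepletionAtTwo

end
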